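import Summits.AtomisticToContinuum.HydrodynamicLimit.Theorems.BoltzmannGreenKubo.Negative.MomentumWitness

/-!
# The energy witness `g_E` and its overlap `m_E ≥ 1` (energy-floor helper file 1/3)

`g_E(w) = r(w₀²) − c_E`, `r(x) = x/(1 + x/1000)`, `c_E = E γ[r(w₀²)]`: bounded (`≤ 1000`), continuous, EVEN and
`γ`-centred — hence `γ`-orthogonal to `span(1, v)` (`gE_orth`) — with energy overlap
`m_E = E γ[g_E(w)(|w|² − 3)] ≥ 1` (`one_le_mE`): the cross-coordinate terms vanish by PAIRWISE INDEPENDENCE of the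
coordinates of `γ` (`integral_coord_mul_coord_of_ne`, transfer to `⊗γ₁` + `iIndepFun_pi`) and centring, and the
diagonal term is bounded below via `r(x)(x−1) ≥ x² − x − x³/1000` using the EXACT fourth moment `E γ₁[x⁴] = 3`
(`integral_pow_four_gaussianReal`: fourth derivative of the mgf `e^{t²/2}`) and `E γ₁[x⁶] ≤ (45/2)e²`.
refuter-cdisprove-stmt-AtomisticToContinuum-13985-0 (crux BoltzmannGreenKubo, stmt-13985; see `Cruxes/BoltzmannGreenKubo/Disproof.lean` §1i).
-/

noncomputable section

namespace Summit.AtomisticToContinuum.HydrodynamicLimit.Theorems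

open MeasureTheory ProbabilityTheory Filter Topology Set
open Literature.Analysis.FluidPDE Literature.MathematicalPhysics.KineticTheory
open Literature.Analysis.UnboundedOperators
open scoped InnerProductSpace
open BoltzmannGreenKuboForallN

namespace BoltzmannGreenKuboOrthMomentum

section EnergyWitness

/-- Exact Gaussian fourth moment `E γ₁[x⁴] = 3` (fourth derivative of the mgf `t ↦ e^{t²/2}` at `0`). [folklore] -/
theorem integral_pow_four_gaussianReal : ∫ x, x ^ 4 ∂gaussianReal 0 1 = 3 := by
  have h1 : ∫ x, x ^ 4 ∂gaussianReal 0 1 = iteratedDeriv 4 (mgf (fun x => x) (gaussianReal 0 1)) 0 := by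
    rw [iteratedDeriv_mgf_zero] <;> simp
  rw [h1, mgf_fun_id_gaussianReal]
  have hf : (fun t : ℝ => Real.exp (0 * t + ((1 : NNReal) : ℝ) * t ^ 2 / 2)) = fun t => Real.exp (t ^ 2 / 2) := by
    funext t; simp
  rw [hf]
  -- derivatives of e^{t²/2}
  have hq : ∀ t : ℝ, HasDerivAt (fun t : ℝ => t ^ 2 / 2) t t := by
    intro t
    have h := (hasDerivAt_pow 2 t).div_const 2
    refine h.congr_deriv ?_
    norm_num
  have e0 : ∀ t : ℝ, HasDerivAt (fun t : ℝ => Real.exp (t ^ 2 / 2)) (Real.exp (t ^ 2 / 2) * t) t :=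
    fun t => (hq t).exp
  have d1 : deriv (fun t : ℝ => Real.exp (t ^ 2 / 2)) = fun t => Real.exp (t ^ 2 / 2) * t :=
    funext fun t => (e0 t).deriv
  have hp1 : ∀ t : ℝ, HasDerivAt (fun t : ℝ => t) 1 t := fun t => hasDerivAt_id' t
  have e1 : ∀ t : ℝ, HasDerivAt (fun t : ℝ => Real.exp (t ^ 2 / 2) * t)
      (Real.exp (t ^ 2 / 2) * t * t + Real.exp (t ^ 2 / 2) * 1) t := fun t => (e0 t).mul (hp1 t)
  have d2 : deriv (fun t : ℝ => Real.exp (t ^ 2 / 2) * t) = fun t => Real.exp (t ^ 2 / 2) * (1 + t ^ 2) := by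
    funext t
    rw [(e1 t).deriv]
    ring
  have hp2 : ∀ t : ℝ, HasDerivAt (fun t : ℝ => 1 + t ^ 2) (2 * t) t := by
    intro t
    have h := (hasDerivAt_pow 2 t).const_add 1
    refine h.congr_deriv ?_
    norm_num
  have e2 : ∀ t : ℝ, HasDerivAt (fun t : ℝ => Real.exp (t ^ 2 / 2) * (1 + t ^ 2))
      (Real.exp (t ^ 2 / 2) * t * (1 + t ^ 2) + Real.exp (t ^ 2 / 2) * (2 * t)) t := fun t => (e0 t).mul (hp2 t)
  have d3 : deriv (fun t : ℝ => Real.exp (t ^ 2 / 2) * (1 + t ^ 2)) =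
      fun t => Real.exp (t ^ 2 / 2) * (3 * t + t ^ 3) := by
    funext t
    rw [(e2 t).deriv]
    ring
  have hp3 : ∀ t : ℝ, HasDerivAt (fun t : ℝ => 3 * t + t ^ 3) (3 + 3 * t ^ 2) t := by
    intro t
    have h := ((hasDerivAt_id' t).const_mul 3).add (hasDerivAt_pow 3 t)
    refine h.congr_deriv ?_
    norm_num
  have e3 : ∀ t : ℝ, HasDerivAt (fun t : ℝ => Real.exp (t ^ 2 / 2) * (3 * t + t ^ 3))
      (Real.exp (t ^ 2 / 2) * t * (3 * t + t ^ 3) + Real.exp (t ^ 2 / 2) * (3 + 3 * t ^ 2)) t :=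
    fun t => (e0 t).mul (hp3 t)
  have d4 : deriv (fun t : ℝ => Real.exp (t ^ 2 / 2) * (3 * t + t ^ 3)) =
      fun t => Real.exp (t ^ 2 / 2) * (3 + 6 * t ^ 2 + t ^ 4) := by
    funext t
    rw [(e3 t).deriv]
    ring
  rw [iteratedDeriv_succ, iteratedDeriv_succ, iteratedDeriv_succ, iteratedDeriv_one, d1, d2, d3, d4]
  norm_num

/-- Sixth-moment bound `E γ₁[x⁶] ≤ (45/2) e²` (from `u⁶/6! ≤ eᵘ`). [folklore] -/
theorem integral_pow_six_gaussianReal_le : ∫ x, x ^ 6 ∂gaussianReal 0 1 ≤ 45 / 2 * Real.exp 2 := by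
  have hpt : ∀ y : ℝ, y ^ 6 ≤ 45 / 4 * (Real.exp (2 * y) + Real.exp (-2 * y)) := by
    intro y
    have h1 : (2 * |y|) ^ 6 / (Nat.factorial 6 : ℕ) ≤ Real.exp (2 * |y|) :=
      Real.pow_div_factorial_le_exp (2 * |y|) (by positivity) 6
    have h2 : Real.exp (2 * |y|) ≤ Real.exp (2 * y) + Real.exp (-2 * y) := by
      rcases le_or_gt 0 y with hy | hy
      · rw [abs_of_nonneg hy]
        linarith [Real.exp_pos (-2 * y)]
      · rw [abs_of_neg hy, show 2 * -y = -2 * y by ring]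
        linarith [Real.exp_pos (2 * y)]
    have h3 : (2 * |y|) ^ 6 = 64 * y ^ 6 := by
      have : |y| ^ 6 = y ^ 6 := by
        rw [show (6 : ℕ) = 2 * 3 from rfl, pow_mul, sq_abs, ← pow_mul]
      rw [mul_pow, this]
      norm_num
    have h4 : ((Nat.factorial 6 : ℕ) : ℝ) = 720 := by norm_num [Nat.factorial]
    rw [h3, h4] at h1
    linarith
  have hint6 : Integrable (fun x : ℝ => x ^ 6) (gaussianReal 0 1) := by
    have h := (memLp_id_gaussianReal' (μ := 0) (v := 1) 6 (by simp)).integrable_norm_pow (by norm_num)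
    refine h.congr (Eventually.of_forall fun x => ?_)
    simp only [id, Real.norm_eq_abs]
    rw [show (6 : ℕ) = 2 * 3 from rfl, pow_mul, sq_abs, ← pow_mul]
  have hexp : ∀ t : ℝ, Integrable (fun x => Real.exp (t * x)) (gaussianReal 0 1) := fun t =>
    integrable_exp_mul_gaussianReal t
  calc ∫ x, x ^ 6 ∂gaussianReal 0 1
      ≤ ∫ x, 45 / 4 * (Real.exp (2 * x) + Real.exp (-2 * x)) ∂gaussianReal 0 1 :=
        integral_mono hint6 (((hexp 2).add (hexp (-2))).const_mul _) hpt
    _ = 45 / 4 * (Real.exp 2 + Real.exp 2) := by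
        rw [integral_const_mul, integral_add (hexp 2) (hexp (-2)), integral_exp_mul_gaussianReal,
          integral_exp_mul_gaussianReal]
        norm_num
    _ = 45 / 2 * Real.exp 2 := by ring

/-- `E γ[(w₀)⁴] = 3` on `ℝ³`. [folklore] -/
theorem integral_coord_pow_four : ∫ w, (w 0) ^ 4 ∂stdGaussian V3 = 3 := by
  have h := measurePreserving_coord 0
  calc ∫ w, (w 0) ^ 4 ∂stdGaussian V3
      = ∫ x, x ^ 4 ∂((stdGaussian V3).map fun w : V3 => w 0) :=
        (integral_map h.measurable.aemeasurable (continuous_pow 4).aestronglyMeasurable).symm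
    _ = ∫ x, x ^ 4 ∂gaussianReal 0 1 := by rw [h.map_eq]
    _ = 3 := integral_pow_four_gaussianReal

/-- `E γ[(w₀)⁶] ≤ (45/2)e²` on `ℝ³`. [folklore] -/
theorem integral_coord_pow_six_le : ∫ w, (w 0) ^ 6 ∂stdGaussian V3 ≤ 45 / 2 * Real.exp 2 := by
  have h := measurePreserving_coord 0
  calc ∫ w, (w 0) ^ 6 ∂stdGaussian V3
      = ∫ x, x ^ 6 ∂((stdGaussian V3).map fun w : V3 => w 0) :=
        (integral_map h.measurable.aemeasurable (continuous_pow 6).aestronglyMeasurable).symm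
    _ = ∫ x, x ^ 6 ∂gaussianReal 0 1 := by rw [h.map_eq]
    _ ≤ 45 / 2 * Real.exp 2 := integral_pow_six_gaussianReal_le

/-- `(w₀)⁶` is `γ`-integrable. [folklore] -/
theorem integrable_coord_pow_six : Integrable (fun w : V3 => (w 0) ^ 6) (stdGaussian V3) := by
  have h := measurePreserving_coord 0
  have hint6 : Integrable (fun x : ℝ => x ^ 6) (gaussianReal 0 1) := by
    have h' := (memLp_id_gaussianReal' (μ := 0) (v := 1) 6 (by simp)).integrable_norm_pow (by norm_num)
    refine h'.congr (Eventually.of_forall fun x => ?_)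
    simp only [id, Real.norm_eq_abs]
    rw [show (6 : ℕ) = 2 * 3 from rfl, pow_mul, sq_abs, ← pow_mul]
  exact (h.integrable_comp (continuous_pow 6).aestronglyMeasurable).2 hint6

/-- Every coordinate square is `γ`-integrable with integral `1`. [folklore] -/
theorem integrable_coord_sq' (k : Fin 3) : Integrable (fun w : V3 => (w k) ^ 2) (stdGaussian V3) :=
  (memLp_coord_stdGaussian k 2 (by simp)).integrable_sq

/-- **Pairwise independence of the coordinates of `γ` on `ℝ³`**, in product-integral form: for `k ≠ l` and measurable
`f, g`, `∫ f(w_k) g(w_l) dγ = (∫ f(w_k) dγ)(∫ g(w_l) dγ)` (transfer to `⊗γ₁` and `iIndepFun_pi`). [folklore] -/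
theorem integral_coord_mul_coord_of_ne {k l : Fin 3} (hkl : k ≠ l) {f g : ℝ → ℝ} (hf : Measurable f) (hg : Measurable g) :
    ∫ w, f (w k) * g (w l) ∂stdGaussian V3 = (∫ w, f (w k) ∂stdGaussian V3) * ∫ w, g (w l) ∂stdGaussian V3 := by
  have hmeas : Measurable (WithLp.toLp 2 : (Fin 3 → ℝ) → V3) := (PiLp.continuous_toLp 2 _).measurable
  have htrans : ∀ {F : V3 → ℝ} (hF : Measurable F),
      ∫ w, F w ∂stdGaussian V3 = ∫ x, F (WithLp.toLp 2 x) ∂(Measure.pi fun _ : Fin 3 => gaussianReal 0 1) := by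
    intro F hF
    rw [← map_pi_eq_stdGaussian, integral_map hmeas.aemeasurable hF.aestronglyMeasurable]
  have hk : Measurable fun w : V3 => w k := (EuclideanSpace.proj (𝕜 := ℝ) k).continuous.measurable
  have hl : Measurable fun w : V3 => w l := (EuclideanSpace.proj (𝕜 := ℝ) l).continuous.measurable
  rw [htrans (F := fun w => f (w k) * g (w l)) ((hf.comp hk).mul (hg.comp hl)),
    htrans (F := fun w => f (w k)) (hf.comp hk), htrans (F := fun w => g (w l)) (hg.comp hl)]
  have hind : iIndepFun (fun i (x : Fin 3 → ℝ) => x i) (Measure.pi fun _ : Fin 3 => gaussianReal 0 1) :=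
    iIndepFun_pi (X := fun _ => id) fun _ => aemeasurable_id
  have hpair : IndepFun (fun x : Fin 3 → ℝ => f (x k)) (fun x => g (x l)) (Measure.pi fun _ : Fin 3 => gaussianReal 0 1) :=
    (hind.indepFun hkl).comp hf hg
  exact hpair.integral_fun_mul_eq_mul_integral
    ((hf.comp (measurable_pi_apply k)).aestronglyMeasurable) ((hg.comp (measurable_pi_apply l)).aestronglyMeasurable)

/-- The truncation `r(x) = x / (1 + x/1000)`. [folklore] -/
def rE (x : ℝ) : ℝ := x * (1 + x / 1000)⁻¹

/-- Continuity of `r`. [folklore] -/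
theorem continuous_rE_sq : Continuous fun w : V3 => rE ((w 0) ^ 2) := by
  have h0 : Continuous fun w : V3 => w 0 := (EuclideanSpace.proj (𝕜 := ℝ) (0 : Fin 3)).continuous
  unfold rE
  refine (h0.pow 2).mul ((continuous_const.add ((h0.pow 2).div_const _)).inv₀ fun w => ?_)
  have : (0 : ℝ) < 1 + (w 0) ^ 2 / 1000 := by positivity
  exact this.ne'

/-- `0 ≤ r(x²) ≤ 1000`. [folklore] -/
theorem rE_sq_bounds (w : V3) : 0 ≤ rE ((w 0) ^ 2) ∧ rE ((w 0) ^ 2) ≤ 1000 := by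
  have hpos : 0 < 1 + (w 0) ^ 2 / 1000 := by positivity
  unfold rE
  rw [← div_eq_mul_inv]
  constructor
  · positivity
  · rw [div_le_iff₀ hpos]
    nlinarith [sq_nonneg (w 0)]

/-- The centring constant `c_E = E γ[r(w₀²)] ∈ [0, 1000]`. [folklore] -/
def cE : ℝ := ∫ w, rE ((w 0) ^ 2) ∂stdGaussian V3

/-- Helper (see the module docstring). [folklore] -/
theorem cE_bounds : 0 ≤ cE ∧ cE ≤ 1000 := by
  constructor
  · exact integral_nonneg fun w => (rE_sq_bounds w).1
  · have : ∫ w, rE ((w 0) ^ 2) ∂stdGaussian V3 ≤ ∫ _w, (1000 : ℝ) ∂stdGaussian V3 := by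
      refine integral_mono_of_nonneg (Eventually.of_forall fun w => (rE_sq_bounds w).1) (integrable_const _)
        (Eventually.of_forall fun w => (rE_sq_bounds w).2)
    simpa [cE] using this

/-- THE ENERGY WITNESS `g_E(w) = r(w₀²) − c_E`: bounded, continuous, EVEN, `γ`-centred — hence orthogonal to
`span(1, v)` — but with positive overlap with the (centred) kinetic energy `|w|² − 3`. [folklore] -/
def gE (w : V3) : ℝ := rE ((w 0) ^ 2) - cE

/-- Helper (see the module docstring). [folklore] -/
theorem continuous_gE : Continuous gE := continuous_rE_sq.sub continuous_const

/-- Helper (see the module docstring). [folklore] -/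
theorem abs_gE_le (w : V3) : |gE w| ≤ 1000 := by
  have h1 := rE_sq_bounds w
  have h2 := cE_bounds
  rw [gE, abs_le]
  constructor <;> linarith

/-- Helper (see the module docstring). [folklore] -/
theorem gE_neg (w : V3) : gE (-w) = gE w := by
  have : (-w) 0 = -(w 0) := rfl
  simp only [gE, this, neg_sq]

/-- Helper (see the module docstring). [folklore] -/
theorem integrable_gE : Integrable gE (stdGaussian V3) :=
  (integrable_const (1000 : ℝ)).mono' continuous_gE.aestronglyMeasurable
    (Eventually.of_forall fun w => by rw [Real.norm_eq_abs]; exact abs_gE_le w)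

/-- Helper (see the module docstring). [folklore] -/
theorem integral_gE : ∫ w, gE w ∂stdGaussian V3 = 0 := by
  have hint : Integrable (fun w : V3 => rE ((w 0) ^ 2)) (stdGaussian V3) :=
    (integrable_const (1000 : ℝ)).mono' continuous_rE_sq.aestronglyMeasurable
      (Eventually.of_forall fun w => by
        rw [Real.norm_eq_abs, abs_of_nonneg (rE_sq_bounds w).1]; exact (rE_sq_bounds w).2)
  simp only [gE]
  rw [integral_sub (f := fun w : V3 => rE ((w 0) ^ 2)) (g := fun _ => cE) hint (integrable_const _), integral_const, smul_eq_mul]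
  simp [cE]

/-- `g_E ⊥ span(1, v)` in `L²(γ)` (centring + evenness), in the form of the weakened clause. [folklore] -/
theorem gE_orth (c₀ : ℝ) (b : V3) : ∫ v, gE v * (c₀ + ⟪b, v⟫_ℝ) ∂stdGaussian V3 = 0 := by
  have hlin : Integrable (fun v : V3 => gE v * ⟪b, v⟫_ℝ) (stdGaussian V3) := by
    have hmem : MemLp (fun v : V3 => ⟪b, v⟫_ℝ) 1 (stdGaussian V3) := by
      simpa using IsGaussian.memLp_dual (stdGaussian V3) (innerSL ℝ b) 1 (by simp)
    exact (hmem.integrable le_rfl).bdd_mul (c := 1000) continuous_gE.aestronglyMeasurable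
      (Eventually.of_forall fun w => by rw [Real.norm_eq_abs]; exact abs_gE_le w)
  have e : (fun v : V3 => gE v * (c₀ + ⟪b, v⟫_ℝ)) = fun v => c₀ * gE v + gE v * ⟪b, v⟫_ℝ := by
    funext v; ring
  rw [e, integral_add (f := fun v : V3 => c₀ * gE v) (g := fun v : V3 => gE v * ⟪b, v⟫_ℝ) (integrable_gE.const_mul _) hlin,
    integral_const_mul, integral_gE, mul_zero, zero_add]
  refine BoltzmannGreenKuboForallN.integral_stdGaussian_eq_zero_of_odd (LinearIsometryEquiv.neg ℝ) (fun w => ?_)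
  simp only [LinearIsometryEquiv.coe_neg, gE_neg, inner_neg_right]
  ring

/-- The energy overlap `m_E = E γ[g_E(w)(|w|² − 3)]`. [folklore] -/
def mE : ℝ := ∫ w, gE w * (‖w‖ ^ 2 - 3) ∂stdGaussian V3

/-- Pointwise: `r(x)(x − 1) ≥ x² − x − x³/1000` for `x = w₀² ≥ 0`. [folklore] -/
theorem rE_mul_ge (w : V3) : (w 0) ^ 4 - (w 0) ^ 2 - (w 0) ^ 6 / 1000 ≤ rE ((w 0) ^ 2) * ((w 0) ^ 2 - 1) := by
  have hpos : 0 < 1 + (w 0) ^ 2 / 1000 := by positivity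
  unfold rE
  rw [show (w 0) ^ 2 * (1 + (w 0) ^ 2 / 1000)⁻¹ * ((w 0) ^ 2 - 1) =
      ((w 0) ^ 2 * ((w 0) ^ 2 - 1)) / (1 + (w 0) ^ 2 / 1000) by rw [div_eq_mul_inv]; ring, le_div_iff₀ hpos]
  nlinarith [sq_nonneg (w 0), sq_nonneg ((w 0) ^ 2), sq_nonneg ((w 0) ^ 3), sq_nonneg ((w 0) ^ 4),
    mul_nonneg (sq_nonneg (w 0)) (sq_nonneg ((w 0) ^ 3))]

/-- **The energy overlap is at least `1`**: `m_E = E[r(w₀²)(w₀² − 1)] ≥ E[w₀⁴] − E[w₀²] − E[w₀⁶]/1000 ≥ 3 − 1 − 0.21`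
(independence of the coordinates kills `E[r(w₀²)(w_k² − 1)]`, `k ≠ 0`; centring kills `c_E`). [folklore] -/
theorem one_le_mE : 1 ≤ mE := by
  have h0m : Measurable fun w : V3 => w 0 := (EuclideanSpace.proj (𝕜 := ℝ) (0 : Fin 3)).continuous.measurable
  have hrm : Measurable fun x : ℝ => rE (x ^ 2) := by
    unfold rE
    exact (measurable_id.pow_const 2).mul ((measurable_const.add ((measurable_id.pow_const 2).div_const _)).inv)
  have hr_int : Integrable (fun w : V3 => rE ((w 0) ^ 2)) (stdGaussian V3) :=
    (integrable_const (1000 : ℝ)).mono' continuous_rE_sq.aestronglyMeasurable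
      (Eventually.of_forall fun w => by
        rw [Real.norm_eq_abs, abs_of_nonneg (rE_sq_bounds w).1]; exact (rE_sq_bounds w).2)
  -- split |w|² - 3 = (w₀² - 1) + (w₁² - 1) + (w₂² - 1)
  have hnorm : ∀ w : V3, ‖w‖ ^ 2 - 3 = ((w 0) ^ 2 - 1) + ((w 1) ^ 2 - 1) + ((w 2) ^ 2 - 1) := by
    intro w
    rw [EuclideanSpace.real_norm_sq_eq, Fin.sum_univ_three]
    ring
  have hprod_int : ∀ k : Fin 3, Integrable (fun w : V3 => rE ((w 0) ^ 2) * ((w k) ^ 2 - 1)) (stdGaussian V3) := by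
    intro k
    exact ((integrable_coord_sq' k).sub (integrable_const 1)).bdd_mul (c := 1000) continuous_rE_sq.aestronglyMeasurable
      (Eventually.of_forall fun w => by
        rw [Real.norm_eq_abs, abs_of_nonneg (rE_sq_bounds w).1]; exact (rE_sq_bounds w).2)
  have hgEprod_int : ∀ k : Fin 3, Integrable (fun w : V3 => gE w * ((w k) ^ 2 - 1)) (stdGaussian V3) := by
    intro k
    exact ((integrable_coord_sq' k).sub (integrable_const 1)).bdd_mul (c := 1000) continuous_gE.aestronglyMeasurable
      (Eventually.of_forall fun w => by rw [Real.norm_eq_abs]; exact abs_gE_le w)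
  -- cross coordinates vanish by independence and centring of w_k² - 1
  have hcross : ∀ k : Fin 3, k ≠ 0 → ∫ w, gE w * ((w k) ^ 2 - 1) ∂stdGaussian V3 = 0 := by
    intro k hk
    have hind := integral_coord_mul_coord_of_ne (Ne.symm hk) (f := fun x => rE (x ^ 2) - cE) (g := fun x => x ^ 2 - 1)
      (hrm.sub measurable_const) ((measurable_id.pow_const 2).sub measurable_const)
    beta_reduce at hind
    have hz : ∫ w : V3, ((w k) ^ 2 - 1) ∂stdGaussian V3 = 0 := by
      rw [integral_sub (f := fun w : V3 => (w k) ^ 2) (g := fun _ => (1 : ℝ)) (integrable_coord_sq' k) (integrable_const _),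
        integral_coord_sq_stdGaussian]
      simp
    simp only [gE]
    rw [hind, hz, mul_zero]
  -- the diagonal term
  have hdiag : ∫ w, gE w * ((w 0) ^ 2 - 1) ∂stdGaussian V3 = ∫ w, rE ((w 0) ^ 2) * ((w 0) ^ 2 - 1) ∂stdGaussian V3 := by
    have e : (fun w : V3 => gE w * ((w 0) ^ 2 - 1)) =
        fun w => rE ((w 0) ^ 2) * ((w 0) ^ 2 - 1) - cE * ((w 0) ^ 2 - 1) := by
      funext w; simp only [gE]; ring
    have hq0 : Integrable (fun w : V3 => (w 0) ^ 2 - 1) (stdGaussian V3) := (integrable_coord_sq' 0).sub (integrable_const 1)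
    rw [e, integral_sub (f := fun w : V3 => rE ((w 0) ^ 2) * ((w 0) ^ 2 - 1)) (g := fun w : V3 => cE * ((w 0) ^ 2 - 1))
        (hprod_int 0) (hq0.const_mul cE),
      integral_const_mul, integral_sub (f := fun w : V3 => (w 0) ^ 2) (g := fun _ => (1 : ℝ)) (integrable_coord_sq' 0)
        (integrable_const _), integral_coord_sq_stdGaussian]
    simp
  have hsplit : mE = ∫ w, rE ((w 0) ^ 2) * ((w 0) ^ 2 - 1) ∂stdGaussian V3 := by
    rw [mE]
    have e : (fun w : V3 => gE w * (‖w‖ ^ 2 - 3)) =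
        fun w => (gE w * ((w 0) ^ 2 - 1) + gE w * ((w 1) ^ 2 - 1)) + gE w * ((w 2) ^ 2 - 1) := by
      funext w; rw [hnorm]; ring
    rw [e, integral_add (f := fun w : V3 => gE w * ((w 0) ^ 2 - 1) + gE w * ((w 1) ^ 2 - 1))
        (g := fun w : V3 => gE w * ((w 2) ^ 2 - 1)) ((hgEprod_int 0).add (hgEprod_int 1)) (hgEprod_int 2),
      integral_add (f := fun w : V3 => gE w * ((w 0) ^ 2 - 1)) (g := fun w : V3 => gE w * ((w 1) ^ 2 - 1))
        (hgEprod_int 0) (hgEprod_int 1), hcross 1 (by decide), hcross 2 (by decide), hdiag]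
    ring
  have h42 : Integrable (fun w : V3 => (w 0) ^ 4 - (w 0) ^ 2) (stdGaussian V3) :=
    integrable_coord_pow_four.sub (integrable_coord_sq' 0)
  have h6d : Integrable (fun w : V3 => (w 0) ^ 6 / 1000) (stdGaussian V3) := integrable_coord_pow_six.div_const _
  have h426 : Integrable (fun w : V3 => (w 0) ^ 4 - (w 0) ^ 2 - (w 0) ^ 6 / 1000) (stdGaussian V3) := h42.sub h6d
  have hlow : ∫ w, (w 0) ^ 4 - (w 0) ^ 2 - (w 0) ^ 6 / 1000 ∂stdGaussian V3 ≤
      ∫ w, rE ((w 0) ^ 2) * ((w 0) ^ 2 - 1) ∂stdGaussian V3 :=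
    integral_mono h426 (hprod_int 0) rE_mul_ge
  have hval : ∫ w, (w 0) ^ 4 - (w 0) ^ 2 - (w 0) ^ 6 / 1000 ∂stdGaussian V3 =
      3 - 1 - (∫ w, (w 0) ^ 6 ∂stdGaussian V3) / 1000 := by
    rw [integral_sub (f := fun w : V3 => (w 0) ^ 4 - (w 0) ^ 2) (g := fun w : V3 => (w 0) ^ 6 / 1000) h42 h6d,
      integral_sub (f := fun w : V3 => (w 0) ^ 4) (g := fun w : V3 => (w 0) ^ 2) integrable_coord_pow_four
        (integrable_coord_sq' 0), integral_div, integral_coord_pow_four, integral_coord_sq_stdGaussian]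
  have h6 := integral_coord_pow_six_le
  have he : Real.exp 2 < 9 := by
    have h1e := Real.exp_one_lt_three
    have : Real.exp 2 = Real.exp 1 * Real.exp 1 := by rw [← Real.exp_add]; norm_num
    rw [this]
    nlinarith [Real.exp_pos 1]
  rw [hsplit]
  linarith

end EnergyWitness
end BoltzmannGreenKuboOrthMomentum

end Summit.AtomisticToContinuum.HydrodynamicLimit.Theorems

end
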